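import Mathlib
import HarnessLib
import Summits.QuantumFields.QCD.Theses.SpectralDefectExtinction

/-!
# Line `threshold-fredholm-compactness` — crux `TipNoBinding` (stmt-QuantumFields-8965)

Skeleton of the Birman–Schwinger / threshold-compactness proof of
`Summit.QuantumFields.QCD.Theses.SpectralDefectExtinction.TipNoBinding`
(route `route-QuantumFields-SpectralDefectExtinction`, idea card
`Cruxes/TipNoBinding/Ideas/threshold-fredholm-compactness.md`, triage `TRIAGE-r1-1.md`: pass).

Proof architecture (by contradiction at fixed box radius `R`):

0. `¬ TipNoBinding R` gives a BAD SEQUENCE: tori of sides `L_n > n`, `SU(3)` fields `U_n` trivial off the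
   image of `box 4 R`, reals `t_n ∈ [1/√L_n, 1/(n+1))` with `det (D_W(U_n) − t_n) = 0` (composition, proved here).
1. `compactness_extraction` (PROVED here) — the link data `(U_n(proj y, μ))_{y ∈ box R}` live in the compact group `SU(3)^{box R × 4}`:
   along a subsequence they converge, and the limit is the link data of an `R`-box-supported field `U_∞` on `ℤ⁴`
   (`GaugeConfig 4 0 SU(3)`, `ZMod 0 = ℤ`).
2. `stub_freePropagator` — 4D THRESHOLD REGULARITY of the free massless `r = 1` Wilson resolvent: above the
   floor `t_k ≥ 1/√L_k`, `t_k → 0`, the torus resolvent entries `(D_W^{L_k}(1) − t_k)⁻¹(proj x, proj y)` converge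
   to a translation-invariant, colour-blind kernel `G(x − y)` on `ℤ⁴` whose columns are square-summable and solve
   `D_W^{ℤ⁴}(1) G(· − y) = δ_y` (the zero-mode pole is `L⁻⁴/t ≤ L^{-7/2}`; `|D̂(p)⁻¹| ≲ 1/|p| ∈ L¹ ∩ L²(T⁴)` in d = 4).
3. `stub_freeTorusNoRealEigenvalue` — the free torus operator `D_W^L(1)` has no real eigenvalue in `(0, 2)`
   (its spectrum is `W(p) ± i|s(p)|`; the operator form of the route's `HoleLemma`).
4. `stub_birmanSchwingerLimit` — Birman–Schwinger: an eigenvector of `D_W^{L_k}(U_k)` at `t_k` solves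
   `ψ = −(D_W^{L_k}(1) − t_k)⁻¹ B_k ψ` with `B_k = D_W(U_k) − D_W(1)` supported on the image of `box 4 (R+1)`;
   pulled back to `ℤ⁴` coordinates and normalised on that finite block, a subsequence converges (finite-dimensional
   compactness; entries converge by 1 and 2) to a nonzero solution `φ` of the THRESHOLD Birman–Schwinger equation
   `φ = −G B(U_∞) φ` on `box 4 (R+1)`.
5. `stub_liftZeroMode` — `ψ := −G B(U_∞) φ` on all of `ℤ⁴` is square-summable (finite combination of columns of `G`),
   equals `φ` on the block, and satisfies `D_W^{ℤ⁴}(U_∞) ψ = 0`, `ψ ≠ 0`.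
6. `stub_noL2ZeroMode` — WILSON POSITIVITY `D + D† = Σ_μ ∇_μ^† ∇_μ` (r = 1, m = 0, γ_μ Hermitian, links unitary):
   an `ℓ²(ℤ⁴)` zero mode is covariantly constant, hence has constant site norm, hence vanishes. Contradiction.

All stubs are stated over tree declarations only (`wilsonDirac`, `fundamentalRep`, `GaugeConfig`, `TorusSite`,
`Torus.proj`, `box`) plus Mathlib; the `ℤ⁴` operator is the tree's `wilsonDirac` at `L = 0` read through
`Torus.proj 0 : (Fin 4 → ℤ) → TorusSite 4 0`, acting on `ψ : (Fin 4 → ℤ) × Fin 3 × Fin 4 → ℂ` by the row-finite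
sum `∑' q, D p q * ψ q`.  `TipNoBinding_of` is the sorry-free composition; `sorry` occurs only in `stub_*`.
-/

namespace Summit.QuantumFields.QCD.Cruxes.TipNoBinding.ThresholdFredholmCompactness

open scoped BigOperators Topology
open Filter
open Literature.MathematicalPhysics.QuantumLattice Literature.MathematicalPhysics.QuantumFieldTheory
  Literature.Probability.LatticeModels
open Summit.QuantumFields.QCD.Theses.SpectralDefectExtinction (TipNoBinding)

/-- **Stub `noL2ZeroMode` (Wilson positivity on `ℤ⁴`; card step (i), triage: "true and cheap given
γ = euclideanGamma, r = 1, m = 0" — automatic here since the operator IS the tree's `wilsonDirac` at `L = 0`).**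
For every `SU(3)` lattice gauge field `U` on `ℤ⁴` (no support condition needed), the massless `r = 1`
Wilson–Dirac operator has no nonzero square-summable zero mode: `Re⟨ψ, Dψ⟩ = ½ Σ_μ ‖ψ − V_μ ψ‖²` with
`(V_μ ψ)(x) = U(x,μ) ψ(x + μ̂)` unitary on `ℓ²`, so `Dψ = 0` forces `ψ(x) = U(x,μ) ψ(x+μ̂)`, hence `x ↦ ‖ψ(x)‖`
is constant on `ℤ⁴`, hence `ψ = 0` by summability.  Size: M (ℓ² summation by parts on `ℤ⁴ × colour × spin`,
Hermiticity of `euclideanGamma`, unitarity of `fundamentalRep`).  Leans on: `wilsonDirac`,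
`euclideanGamma_isHermitian`, `fundamentalRep_mem_unitaryGroup`, Mathlib `tsum`/`Summable`. -/
theorem stub_noL2ZeroMode
    (U : GaugeConfig 4 0 ↥(Matrix.specialUnitaryGroup (Fin 3) ℂ))
    (ψ : (Fin 4 → ℤ) × Fin 3 × Fin 4 → ℂ)
    (hψ : Summable fun p => ‖ψ p‖ ^ 2)
    (hD : ∀ p : (Fin 4 → ℤ) × Fin 3 × Fin 4,
      ∑' q : (Fin 4 → ℤ) × Fin 3 × Fin 4,
        wilsonDirac (fundamentalRep (Fin 3)) U 0 1 (Torus.proj 0 p.1, p.2) (Torus.proj 0 q.1, q.2) * ψ q = 0) :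
    ψ = 0 := by
  sorry

/-- **Lemma `compactness_extraction` (card step (iii), the compactness of `SU(3)^{links(R)}`; PROVED here, not
a stub).**  Any sequence of link data on the edges based in `box 4 R` has a subsequence converging in the compact
group `SU(3)^{box R × Fin 4}`, and the limit is the box link data of an `R`-box-supported gauge field on `ℤ⁴`
(extend by `1`; `Torus.proj 0` is injective).  Leans on: `Matrix.specialUnitaryGroup.instCompactSpace` (tree
`GaugeGroups`), Mathlib `CompactSpace.tendsto_subseq`, `ZMod.intCast_eq_intCast_iff_dvd_sub`. -/
theorem compactness_extraction (R : ℕ)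
    (g : ℕ → ↥(box 4 R) → Fin 4 → ↥(Matrix.specialUnitaryGroup (Fin 3) ℂ)) :
    ∃ (U : GaugeConfig 4 0 ↥(Matrix.specialUnitaryGroup (Fin 3) ℂ)) (φ : ℕ → ℕ), StrictMono φ ∧
      (∀ (x : TorusSite 4 0) (μ : Fin 4), (∀ y ∈ box 4 R, Torus.proj 0 y ≠ x) → U (x, μ) = 1) ∧
      Tendsto (fun k => g (φ k)) atTop
        (𝓝 fun (y : ↥(box 4 R)) (μ : Fin 4) => U (Torus.proj 0 (y : Fin 4 → ℤ), μ)) := by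
  classical
  -- Bolzano–Weierstrass in the compact metrisable group `SU(3)^{box R × Fin 4}`.
  obtain ⟨gstar, φ, hφ, hlim⟩ := CompactSpace.tendsto_subseq g
  -- `Torus.proj 0 : ℤ⁴ → (ZMod 0)⁴` is injective.
  have hinj : ∀ y y' : Fin 4 → ℤ, Torus.proj 0 y = Torus.proj 0 y' → y = y' := by
    intro y y' h
    funext i
    have hi := congrFun h i
    rw [Torus.proj_apply, Torus.proj_apply, ZMod.intCast_eq_intCast_iff_dvd_sub] at hi
    simp only [Nat.cast_zero, zero_dvd_iff, sub_eq_zero] at hi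
    exact hi.symm
  -- Extend the limiting link data by `1` off the box.
  refine ⟨fun e => if h : ∃ y : ↥(box 4 R), Torus.proj 0 (y : Fin 4 → ℤ) = e.1 then gstar h.choose e.2 else 1,
    φ, hφ, ?_, ?_⟩
  · intro x μ hx
    have hne : ¬ ∃ y : ↥(box 4 R), Torus.proj 0 (y : Fin 4 → ℤ) = x := fun ⟨y, hy⟩ => hx y y.2 hy
    exact dif_neg hne
  · show Tendsto (fun k => g (φ k)) atTop (𝓝 fun (y : ↥(box 4 R)) (μ : Fin 4) =>
      if h : ∃ y' : ↥(box 4 R), Torus.proj 0 (y' : Fin 4 → ℤ) = Torus.proj 0 (y : Fin 4 → ℤ)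
      then gstar h.choose μ else 1)
    have hU : (fun (y : ↥(box 4 R)) (μ : Fin 4) =>
        if h : ∃ y' : ↥(box 4 R), Torus.proj 0 (y' : Fin 4 → ℤ) = Torus.proj 0 (y : Fin 4 → ℤ)
        then gstar h.choose μ else 1) = gstar := by
      funext y μ
      have h : ∃ y' : ↥(box 4 R), Torus.proj 0 (y' : Fin 4 → ℤ) = Torus.proj 0 (y : Fin 4 → ℤ) := ⟨y, rfl⟩
      simp only [dif_pos h]
      rw [Subtype.ext (hinj _ _ h.choose_spec)]
    rw [hU]
    exact hlim

/-- **Stub `freePropagator` (card step (ii) + (iv): the massless 4D Wilson propagator is locally finite and is the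
threshold limit of the torus resolvents above the floor).**  There is a kernel `G : ℤ⁴ → M₄(ℂ)` such that
(a) for all sequences of tori `L_k > k` and reals `t_k ≥ 1/√L_k`, `t_k → 0`, every entry of the free resolvent
`(D_W^{L_k}(1) − t_k)⁻¹` between the images of two fixed `ℤ⁴` points `x, y` converges to `δ_{ab} G(x − y)_{αβ}`
(Fourier sum `L⁻⁴ Σ_p e^{ip(x−y)} (W(p) − t + iγ·s(p))⁻¹`: the `p = 0` term is `L⁻⁴/t ≤ L^{-7/2}`, the rest is a
Riemann sum of a function with an integrable `1/|p|` singularity and `1/|p|²`-integrable gradient in `d = 4`,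
dominated uniformly in `t ≤ 1/4` by the triager's `(W − t)² + s² ≥ (9/16) W`); and (b) every column
`p ↦ δ_{p.colour, b} G(p.site − y)_{p.spin, β}` is square-summable on `ℤ⁴ × Fin 3 × Fin 4` (Plancherel,
`|D̂(p)⁻¹|² ≲ 1/|p|² ∈ L¹(T⁴)`) and is a fundamental solution of the free `ℤ⁴` operator with source at
`(y, b, β)` (pass to the limit in the finite row identity `(D^{L}(1) − t) (D^{L}(1) − t)⁻¹ = 1`).
Size: L (lattice Fourier analysis on `(ZMod L)⁴` and `T⁴`, absent from tree and Mathlib beyond 1-D `ZMod.dft`).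
Leans on: `wilsonDirac`, `euclideanGamma_anticomm_holds`, route support `HoleLemma` (stmt-8969, proved),
triage lemma `tip_symbol_bound_trig` (evidence Scratch.lean on stmt-8965). -/
theorem stub_freePropagator :
    ∃ G : (Fin 4 → ℤ) → Matrix (Fin 4) (Fin 4) ℂ,
      (∀ (Lk : ℕ → ℕ) [∀ k, NeZero (Lk k)] (tk : ℕ → ℝ),
        (∀ k, k < Lk k) → (∀ k, 1 / Real.sqrt (Lk k : ℝ) ≤ tk k) → Tendsto tk atTop (𝓝 0) →
        ∀ (x y : Fin 4 → ℤ) (a b : Fin 3) (α β : Fin 4),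
          Tendsto (fun k =>
            ((wilsonDirac (fundamentalRep (Fin 3))
                (1 : GaugeConfig 4 (Lk k) ↥(Matrix.specialUnitaryGroup (Fin 3) ℂ)) 0 1
              - ((tk k : ℝ) : ℂ) • (1 : Matrix _ _ ℂ))⁻¹ :
                Matrix (TorusSite 4 (Lk k) × Fin 3 × Fin 4) (TorusSite 4 (Lk k) × Fin 3 × Fin 4) ℂ)
              (Torus.proj (Lk k) x, a, α) (Torus.proj (Lk k) y, b, β)) atTop
            (𝓝 (if a = b then G (x - y) α β else 0))) ∧
      (∀ (y : Fin 4 → ℤ) (b : Fin 3) (β : Fin 4),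
        (Summable fun p : (Fin 4 → ℤ) × Fin 3 × Fin 4 =>
          ‖(if p.2.1 = b then G (p.1 - y) p.2.2 β else 0 : ℂ)‖ ^ 2) ∧
        ∀ p : (Fin 4 → ℤ) × Fin 3 × Fin 4,
          ∑' q : (Fin 4 → ℤ) × Fin 3 × Fin 4,
            wilsonDirac (fundamentalRep (Fin 3))
                (1 : GaugeConfig 4 0 ↥(Matrix.specialUnitaryGroup (Fin 3) ℂ)) 0 1
                (Torus.proj 0 p.1, p.2) (Torus.proj 0 q.1, q.2)
              * (if q.2.1 = b then G (q.1 - y) q.2.2 β else 0) =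
            if p = (y, b, β) then 1 else 0) := by
  sorry

/-- **Stub `freeTorusNoRealEigenvalue` (operator form of the route's `HoleLemma`; used inside the
Birman–Schwinger step to invert `D_W^L(1) − t`).**  On every torus `(ZMod L)⁴`, `L ≥ 1`, the free massless
`r = 1` Wilson–Dirac operator is normal with eigenvalues `W(p) ± i|s(p)|`, `p ∈ (2π/L) ℤ_L⁴`, which are real only
at `W ∈ {0, 2, 4, 6, 8}`; hence `det (D_W^L(1) − t) ≠ 0` for `0 < t < 2`.  Size: M (plane-wave diagonalisation
on the discrete torus, `(γ·s)² = |s|²` from `euclideanGamma_anticomm_holds`).  Leans on: `wilsonDirac`,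
`euclideanGamma_anticomm_holds`, `HoleLemma` (stmt-8969). -/
theorem stub_freeTorusNoRealEigenvalue (L : ℕ) [NeZero L] (t : ℝ) (ht0 : 0 < t) (ht2 : t < 2) :
    (wilsonDirac (fundamentalRep (Fin 3)) (1 : GaugeConfig 4 L ↥(Matrix.specialUnitaryGroup (Fin 3) ℂ)) 0 1
        - (t : ℂ) • (1 : Matrix _ _ ℂ)).det ≠ 0 := by
  sorry

/-- **Stub `birmanSchwingerLimit` (card step (iii): continuity of the finite Birman–Schwinger problem at the
threshold; the LOAD-BEARING stub).**  Data: an `R`-box-supported field `U` on `ℤ⁴`; tori `L_k > k` with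
`R`-box-supported fields `U_k` whose box link data converge to those of `U`; reals `t_k ≥ 1/√L_k`, `t_k → 0`, with
`det (D_W^{L_k}(U_k) − t_k) = 0`; a kernel `G` that is the entrywise limit of `(D_W^{L_k}(1) − t_k)⁻¹` along this
sequence (from `stub_freePropagator` (a)); and the free invertibility `stub_freeTorusNoRealEigenvalue`.
Claim: the THRESHOLD Birman–Schwinger equation `φ = −G B(U) φ` on the block `box 4 (R+1) × Fin 3 × Fin 4`
(`B(U) = D_W^{ℤ⁴}(U) − D_W^{ℤ⁴}(1)`, supported there) has a nonzero solution.  Proof: a null vector `ψ_k` of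
`D_W^{L_k}(U_k) − t_k` satisfies `ψ_k = −(D^{L_k}(1) − t_k)⁻¹ B_k ψ_k` (invertible for `0 < t_k < 2`); its
restriction to the image of the block is nonzero, pull it back by `Torus.proj (L_k)` (injective on `box 4 (R+2)`
once `L_k > 2R+4`), normalise, extract a convergent subsequence on the unit sphere of the fixed finite-dimensional
space, and pass to the limit entrywise (`B_k(proj r, proj q) → B(U)(r, q)` by link convergence and continuity of the
inclusion `fundamentalRep`).  Size: L.  Leans on: `Matrix.exists_mulVec_eq_zero_iff`, `Matrix.nonsing_inv`,
compactness of spheres in `EuclideanSpace`, `continuous_fundamentalRep`. -/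
theorem stub_birmanSchwingerLimit (R : ℕ)
    (hfree : ∀ (L : ℕ) [NeZero L] (t : ℝ), 0 < t → t < 2 →
      (wilsonDirac (fundamentalRep (Fin 3)) (1 : GaugeConfig 4 L ↥(Matrix.specialUnitaryGroup (Fin 3) ℂ)) 0 1
        - (t : ℂ) • (1 : Matrix _ _ ℂ)).det ≠ 0)
    (G : (Fin 4 → ℤ) → Matrix (Fin 4) (Fin 4) ℂ)
    (U : GaugeConfig 4 0 ↥(Matrix.specialUnitaryGroup (Fin 3) ℂ))
    (hU : ∀ (x : TorusSite 4 0) (μ : Fin 4), (∀ y ∈ box 4 R, Torus.proj 0 y ≠ x) → U (x, μ) = 1)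
    (Lk : ℕ → ℕ) [∀ k, NeZero (Lk k)]
    (Uk : (k : ℕ) → GaugeConfig 4 (Lk k) ↥(Matrix.specialUnitaryGroup (Fin 3) ℂ))
    (tk : ℕ → ℝ)
    (hLk : ∀ k, k < Lk k)
    (hsupp : ∀ (k : ℕ) (x : TorusSite 4 (Lk k)) (μ : Fin 4),
      (∀ y ∈ box 4 R, Torus.proj (Lk k) y ≠ x) → Uk k (x, μ) = 1)
    (hconv : Tendsto (fun k => fun (y : ↥(box 4 R)) (μ : Fin 4) => Uk k (Torus.proj (Lk k) (y : Fin 4 → ℤ), μ))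
      atTop (𝓝 fun (y : ↥(box 4 R)) (μ : Fin 4) => U (Torus.proj 0 (y : Fin 4 → ℤ), μ)))
    (hfloor : ∀ k, 1 / Real.sqrt (Lk k : ℝ) ≤ tk k)
    (ht : Tendsto tk atTop (𝓝 0))
    (hdet : ∀ k, (wilsonDirac (fundamentalRep (Fin 3)) (Uk k) 0 1
        - ((tk k : ℝ) : ℂ) • (1 : Matrix _ _ ℂ)).det = 0)
    (hG : ∀ (x y : Fin 4 → ℤ) (a b : Fin 3) (α β : Fin 4),
      Tendsto (fun k =>
        ((wilsonDirac (fundamentalRep (Fin 3))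
            (1 : GaugeConfig 4 (Lk k) ↥(Matrix.specialUnitaryGroup (Fin 3) ℂ)) 0 1
          - ((tk k : ℝ) : ℂ) • (1 : Matrix _ _ ℂ))⁻¹ :
            Matrix (TorusSite 4 (Lk k) × Fin 3 × Fin 4) (TorusSite 4 (Lk k) × Fin 3 × Fin 4) ℂ)
          (Torus.proj (Lk k) x, a, α) (Torus.proj (Lk k) y, b, β)) atTop
        (𝓝 (if a = b then G (x - y) α β else 0))) :
    ∃ φ : (Fin 4 → ℤ) × Fin 3 × Fin 4 → ℂ,
      φ ≠ 0 ∧ (∀ p, p.1 ∉ box 4 (R + 1) → φ p = 0) ∧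
      ∀ p, p.1 ∈ box 4 (R + 1) →
        φ p = -∑ r ∈ (box 4 (R + 1)) ×ˢ ((Finset.univ : Finset (Fin 3)) ×ˢ (Finset.univ : Finset (Fin 4))),
               ∑ q ∈ (box 4 (R + 1)) ×ˢ ((Finset.univ : Finset (Fin 3)) ×ˢ (Finset.univ : Finset (Fin 4))),
                 (if p.2.1 = r.2.1 then G (p.1 - r.1) p.2.2 r.2.2 else 0) *
                 (wilsonDirac (fundamentalRep (Fin 3)) U 0 1 (Torus.proj 0 r.1, r.2) (Torus.proj 0 q.1, q.2)
                   - wilsonDirac (fundamentalRep (Fin 3))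
                       (1 : GaugeConfig 4 0 ↥(Matrix.specialUnitaryGroup (Fin 3) ℂ)) 0 1
                       (Torus.proj 0 r.1, r.2) (Torus.proj 0 q.1, q.2)) * φ q := by
  sorry

/-- **Stub `liftZeroMode` (card step (ii), "threshold solutions ARE ℓ² in d = 4", in its Plancherel form).**
A nonzero solution `φ` of the threshold Birman–Schwinger equation on the block `box 4 (R+1) × Fin 3 × Fin 4`
lifts to `ψ := −G B(U) φ` on all of `ℤ⁴`: a finite combination of columns of `G`, hence square-summable by
`stub_freePropagator` (b); `D_W^{ℤ⁴}(1) ψ = −B(U) φ` by the fundamental-solution identity; `ψ = φ` on the block by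
the equation, so `B(U) ψ = B(U) φ` (`B(U)` only sees the block, by the `R`-box support of `U`) and
`D_W^{ℤ⁴}(U) ψ = D_W^{ℤ⁴}(1) ψ + B(U) ψ = 0`, `ψ ≠ 0`.  Size: M (finite sums against the row-finite `∑'`,
support bookkeeping of `B(U)` from `hU`).  Leans on: `wilsonDirac`, `tsum_eq_sum`, `Finset.sum_comm`. -/
theorem stub_liftZeroMode (R : ℕ)
    (G : (Fin 4 → ℤ) → Matrix (Fin 4) (Fin 4) ℂ)
    (hGb : ∀ (y : Fin 4 → ℤ) (b : Fin 3) (β : Fin 4),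
        (Summable fun p : (Fin 4 → ℤ) × Fin 3 × Fin 4 =>
          ‖(if p.2.1 = b then G (p.1 - y) p.2.2 β else 0 : ℂ)‖ ^ 2) ∧
        ∀ p : (Fin 4 → ℤ) × Fin 3 × Fin 4,
          ∑' q : (Fin 4 → ℤ) × Fin 3 × Fin 4,
            wilsonDirac (fundamentalRep (Fin 3))
                (1 : GaugeConfig 4 0 ↥(Matrix.specialUnitaryGroup (Fin 3) ℂ)) 0 1
                (Torus.proj 0 p.1, p.2) (Torus.proj 0 q.1, q.2)
              * (if q.2.1 = b then G (q.1 - y) q.2.2 β else 0) =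
            if p = (y, b, β) then 1 else 0)
    (U : GaugeConfig 4 0 ↥(Matrix.specialUnitaryGroup (Fin 3) ℂ))
    (hU : ∀ (x : TorusSite 4 0) (μ : Fin 4), (∀ y ∈ box 4 R, Torus.proj 0 y ≠ x) → U (x, μ) = 1)
    (φ : (Fin 4 → ℤ) × Fin 3 × Fin 4 → ℂ) (hφ0 : φ ≠ 0)
    (hφsupp : ∀ p, p.1 ∉ box 4 (R + 1) → φ p = 0)
    (hBS : ∀ p, p.1 ∈ box 4 (R + 1) →
        φ p = -∑ r ∈ (box 4 (R + 1)) ×ˢ ((Finset.univ : Finset (Fin 3)) ×ˢ (Finset.univ : Finset (Fin 4))),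
               ∑ q ∈ (box 4 (R + 1)) ×ˢ ((Finset.univ : Finset (Fin 3)) ×ˢ (Finset.univ : Finset (Fin 4))),
                 (if p.2.1 = r.2.1 then G (p.1 - r.1) p.2.2 r.2.2 else 0) *
                 (wilsonDirac (fundamentalRep (Fin 3)) U 0 1 (Torus.proj 0 r.1, r.2) (Torus.proj 0 q.1, q.2)
                   - wilsonDirac (fundamentalRep (Fin 3))
                       (1 : GaugeConfig 4 0 ↥(Matrix.specialUnitaryGroup (Fin 3) ℂ)) 0 1
                       (Torus.proj 0 r.1, r.2) (Torus.proj 0 q.1, q.2)) * φ q) :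
    ∃ ψ : (Fin 4 → ℤ) × Fin 3 × Fin 4 → ℂ,
      ψ ≠ 0 ∧ (Summable fun p => ‖ψ p‖ ^ 2) ∧
      ∀ p : (Fin 4 → ℤ) × Fin 3 × Fin 4,
        ∑' q : (Fin 4 → ℤ) × Fin 3 × Fin 4,
          wilsonDirac (fundamentalRep (Fin 3)) U 0 1 (Torus.proj 0 p.1, p.2) (Torus.proj 0 q.1, q.2) * ψ q = 0 := by
  sorry

/-- **Composition (kernel-checked, sorry-free): the five stubs (and the proved compactness lemma) imply the crux, literally
`Summit.QuantumFields.QCD.Theses.SpectralDefectExtinction.TipNoBinding`.**  At fixed `R`, by contradiction: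
extract the bad sequence from `¬ (∃ lam > 0, ∃ L₀, …)`, apply `compactness_extraction` to its link data, reindex along the
subsequence, feed `stub_freePropagator`, `stub_freeTorusNoRealEigenvalue`, `stub_birmanSchwingerLimit`,
`stub_liftZeroMode`, and contradict `stub_noL2ZeroMode`. -/
theorem TipNoBinding_of : TipNoBinding := by
  intro R
  by_contra hR
  -- Step 0: the bad sequence (one bad torus field per `n`, with `lam = 1/(n+1)`, `L₀ = n+1`).
  have bad : ∀ n : ℕ, ∃ (L : ℕ) (_ : NeZero L), n < L ∧
      ∃ U : GaugeConfig 4 L ↥(Matrix.specialUnitaryGroup (Fin 3) ℂ),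
        (∀ (x : TorusSite 4 L) (μ : Fin 4), (∀ y ∈ box 4 R, Torus.proj L y ≠ x) → U (x, μ) = 1) ∧
        ∃ t : ℝ, 1 / Real.sqrt (L : ℝ) ≤ t ∧ t < 1 / ((n : ℝ) + 1) ∧
          (wilsonDirac (fundamentalRep (Fin 3)) U 0 1 - (t : ℂ) • (1 : Matrix _ _ ℂ)).det = 0 := by
    intro n
    by_contra hn
    apply hR
    refine ⟨1 / ((n : ℝ) + 1), by positivity, n + 1, ?_⟩
    intro L _ hL U hU t ht htn hdet
    exact hn ⟨L, ‹NeZero L›, hL, U, hU, t, ht, htn, hdet⟩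
  choose Ln hne hLn Un hsupp tn hfloor hsmall hdet using bad
  -- Step 1: compactness of the box link data.
  obtain ⟨U, φ, hφ, hU, hconv⟩ := compactness_extraction R
    (fun n (y : ↥(box 4 R)) (μ : Fin 4) => Un n (Torus.proj (Ln n) (y : Fin 4 → ℤ), μ))
  -- Step 2: the threshold propagator.
  obtain ⟨G, hGa, hGb⟩ := stub_freePropagator
  -- Reindex along the subsequence `φ`.
  haveI hneφ : ∀ k, NeZero (Ln (φ k)) := fun k => hne (φ k)
  have hLk : ∀ k, k < Ln (φ k) := fun k => lt_of_le_of_lt (hφ.id_le k) (hLn (φ k))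
  have hfl : ∀ k, 1 / Real.sqrt (Ln (φ k) : ℝ) ≤ tn (φ k) := fun k => hfloor (φ k)
  have ht0 : Tendsto (fun k => tn (φ k)) atTop (𝓝 0) := by
    refine tendsto_of_tendsto_of_tendsto_of_le_of_le tendsto_const_nhds
      (tendsto_one_div_add_atTop_nhds_zero_nat.comp hφ.tendsto_atTop) (fun k => ?_) (fun k => ?_)
    · exact le_trans (by positivity) (hfloor (φ k))
    · exact (hsmall (φ k)).le
  have hG := hGa (fun k => Ln (φ k)) (fun k => tn (φ k)) hLk hfl ht0
  -- Steps 3–4: Birman–Schwinger at the threshold.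
  obtain ⟨φv, hφv0, hφvsupp, hBS⟩ :=
    stub_birmanSchwingerLimit R (fun L _ t h0 h2 => stub_freeTorusNoRealEigenvalue L t h0 h2) G U hU
      (fun k => Ln (φ k)) (fun k => Un (φ k)) (fun k => tn (φ k)) hLk (fun k => hsupp (φ k)) hconv hfl ht0
      (fun k => hdet (φ k)) hG
  -- Step 5: lift to an ℓ² zero mode on ℤ⁴.
  obtain ⟨ψ, hψ0, hψ2, hψD⟩ := stub_liftZeroMode R G hGb U hU φv hφv0 hφvsupp hBS
  -- Step 6: Wilson positivity forbids it.
  exact hψ0 (stub_noL2ZeroMode U ψ hψ2 hψD)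

end Summit.QuantumFields.QCD.Cruxes.TipNoBinding.ThresholdFredholmCompactness
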